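import Literature.FieldTheory.FunctionField.RationalPolynomialDecompositions
import Literature.FieldTheory.FunctionField.RationalClosedPointRamificationIndex
import HarnessLib

/-!
# Indecomposable rational functions by the order at infinity: `x^{n+1}/(x − 1)` is indecomposable over every field,
# and Gutierrez–Sevilla's Theorem 20 (i) — `h_q = (x^{q+1}+x+1)/x^q` is indecomposable (Gutierrez–Sevilla 2006,
# Thm 20 (i); parts (ii), (iii) are already the tree's `isCoatom_adjoin_X_pow_sub_X` /
# `not_isCoatom_adjoin_X_pow_sub_X` / `gutierrezSevilla_indecomposable` in `RationalWildDecompositions`)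

Topic `Literature/FieldTheory/FunctionField`; namespace `Literature.FieldTheory.FunctionField`.  Lane
`lit-hodgefound` (Track 2 foundations library), seat p01 gen 28, row g28-#14 — sequel BY IMPORT of g25-#2
`RationalClosedPointRamificationIndex` (`order_ratFuncExpansionAtInfty_ratFuncSubst_eq_mul_of_lt`:
`v_∞(f ∘ w) = v_∞(f)·e_∞(w)` at a pole of `w`; `order_ratFuncExpansionAtInfty = −intDegree`), g26-#1
`RationalLurothLattice` (`isCoatom` API, `covBy_adjoin_ratFuncSubst_iff`, `adjoin_eq_adjoin_iff_exists_ratFuncSubst`,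
`max_natDegree_ratFuncSubst`), g26-#2 `RationalPolynomialDecompositions` (`adjoin_inv_eq`, `adjoin_sub_C_eq`,
`natDegree_num_div_and_denom_div_of_isCoprime`) and Mathlib (`RatFunc.intDegree_mul/_inv/_polynomial`,
`Polynomial.degree_sub_lt`, `add_pow_char_pow`).  Parts (ii)–(iii) of Theorem 20 are NOT restated: they are the
tree's `isCoatom_adjoin_X_pow_sub_X`, `not_isCoatom_adjoin_X_pow_sub_X`, `gutierrezSevilla_indecomposable`
(`RationalWildDecompositions`).  THEOREMS ONLY (no definition, no named fact, no instance, no notation;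
D-0014/D-0026, net Literature debt 0).

## Source, VERBATIM (J. Gutierrez, D. Sevilla [GutierrezSevilla2006], held `paper:arxiv-0803.3976`, p0006)

«The polynomial `P_q` has at least two different decompositions: `P_q = x^{q−1} ∘ (x^q − x) = (x(x−1)^{q−1}) ∘ x^{q−1}`.
This gives at least two decompositions for `h_q`, both involving the component `(x^{q+1}+x+1)/x^q`.
Theorem 20. (i) `(x^{q+1}+x+1)/x^q` is indecomposable. (ii) `x^q − x` is decomposable iff `q` is composite, that
is, `q = p^m` with `m ≥ 2`. (iii) `x(x−1)^{q−1}` is indecomposable.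
Proof. (i) We will prove that for certain units `u, v ∈ 𝔽_q(x)`, the function `u ∘ (x^{q+1}+x+1)/x^q ∘ v` is
indecomposable. In particular, let `u = x + 1`, `v = 1/(x − 1)`. Then `u ∘ (x^{q+1}+x+1)/x^q ∘ v = x^{q+1}/(x−1)`. As
the degree is multiplicative with respect to composition, and so is the difference in the degrees of numerator and
denominator (see [Sev04]), there is no possible decomposition for this function and the original function is also
indecomposable. (ii) As `G(x^q−x) = {x − a : a ∈ 𝔽_q}` and `|G(x^q−x)| = q = deg x^q−x`, by Theorem (props-fix)
there is a bijection between the decompositions of `x^q−x` and the subgroups of its fixing group. But `G(x^q−x)` has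
proper subgroups if and only if its order is composite. (iii) Let `q = p^m`. Let `x(x−1)^{q−1} = g(h)` with
`g = x^{p^r} + g₀`, `deg g₀ ≤ p^r − 1` and `h = x^{p^s} + h₀`, `deg h₀ ≤ p^s − 1`. Then
`g ∘ h = h^{p^r} + g₀ ∘ h = (x^{p^s} + h₀)^{p^r} + g₀ ∘ h = x^q + h₀^{p^r} + g₀ ∘ h` with `deg h₀^{p^r} ≤ q − p^r` and
`deg g₀ ∘ h ≤ q − p^s`. But `x(x−1)^{q−1} = x^q + x^{q−1} + … + x² + x`, thus either `r = 0` or `s = 0` and the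
decomposition is trivial. □»

## What is formalised (`K` any field in §1–§2; `char K = p` in §3; «indecomposable» = `IsCoatom K(f)`, g26-#1)

* §1 ORDER AT INFINITY: **`intDegree_ratFuncSubst_of_lt`** — `intDegree (f ∘ w) = intDegree f · intDegree w` when
  `w` has a pole at `∞` (the correct form of «the difference in the degrees of numerator and denominator is
  multiplicative»: it is the negative of the valuation at `∞`, multiplicative once `w(∞) = ∞`);
  `intDegree_le_max_natDegree`; **`exists_adjoin_eq_natDegree_denom_lt`** — every non-constant generator can be
  replaced by a Möbius image (`h`, `1/h`, `1/(h − h(∞))`) with the same field and a pole at `∞`.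
* §2 **`isCoatom_adjoin_X_pow_succ_div_X_sub_one`** — `x^{n+1}/(x − 1)` IS INDECOMPOSABLE OVER EVERY FIELD for
  every `n ≥ 1` (so there are indecomposable rational functions of every degree `≥ 2` over every field): for
  `f = g ∘ h` with `h(∞) = ∞`, `deg g · deg h = n + 1` and `intDegree g · intDegree h = n`, incompatible with
  `0 < intDegree h ≤ deg h`, `intDegree g ≤ deg g` unless a degree is `1`;
  `isCoatom_adjoin_ratFuncSubst_of_max_natDegree_eq_one` (indecomposability is invariant under right units).
* §3 THEOREM 20 (i): **`gutierrezSevilla_theorem_20_i`** (`h_q` indecomposable, any field of characteristic `p`,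
  `q = p^m`, `m ≥ 0`: `h_q + 1 = (x^{q+1}/(x−1)) ∘ ((x+1)/x)`).

## Honest deviations

(i) GS's units are `u = x+1`, `v = 1/(x−1)`; we use the equivalent `h_q + 1 = f ∘ ((x+1)/x)` and prove the
indecomposability of `f = x^{q+1}/(x−1)` for ALL exponents and all fields, with the order at infinity in place of
the unproved remark «so is the difference in the degrees» (true only after normalising `h(∞) = ∞`, §1).

## References
* [GutierrezSevilla2006] J. Gutierrez, D. Sevilla, *On Ritt's decomposition theorem in the case of finite fields*,
  Finite Fields Appl. 12 (2006) 403–412, §3 Theorem 20 (and the proof sketch citing [Sev04] = D. Sevilla, PhD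
  thesis, Cantabria 2004).
-/

open Polynomial IntermediateField

namespace Literature.FieldTheory.FunctionField

variable {K : Type*} [Field K]

section IntDegree

/-! ### §1. The order at infinity under composition; normalising a generator -/

/-- **The order at infinity is multiplicative under composition with a function having a pole at `∞`**:
`intDegree (f ∘ w) = intDegree f · intDegree w` whenever `intDegree w > 0` (i.e. `deg num w > deg denom w`) — «so is
the difference in the degrees of numerator and denominator (see [Sev04])».
[cite: GutierrezSevilla2006, §3 Thm 20 (i) (proof)][cite: Stichtenoth2009, Def. 3.1.5, Prop. 1.2.1 (c)] -/
theorem intDegree_ratFuncSubst_of_lt {w : RatFunc K} (hw : ¬ ∃ c, w = RatFunc.C c)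
    (h : w.denom.natDegree < w.num.natDegree) {f : RatFunc K} (hf : f ≠ 0) :
    (ratFuncSubst w hw f).intDegree = f.intDegree * w.intDegree := by
  have h1 := order_ratFuncExpansionAtInfty_ratFuncSubst_eq_mul_of_lt hw h hf
  have hne : ratFuncSubst w hw f ≠ 0 := (map_ne_zero_iff _ (ratFuncSubst_injective w hw)).mpr hf
  rw [order_ratFuncExpansionAtInfty _ hne, order_ratFuncExpansionAtInfty _ hf, ratFuncRamificationIndexAtInfty_of_lt h]
    at h1
  have hw' : w.intDegree = ((w.num.natDegree - w.denom.natDegree : ℕ) : ℤ) := by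
    rw [RatFunc.intDegree]; omega
  rw [hw']
  linarith

/-- `intDegree f ≤ deg f`. [cite: GutierrezSevilla2006, §3 Thm 20 (i) (proof)] -/
theorem intDegree_le_max_natDegree (f : RatFunc K) :
    f.intDegree ≤ (max f.num.natDegree f.denom.natDegree : ℕ) := by
  rw [RatFunc.intDegree]
  have := le_max_left f.num.natDegree f.denom.natDegree
  omega

/-- **Normalising a generator to have a pole at infinity**: every non-constant `h ∈ K(u)` has a Möbius image `h'`
(`h`, `1/h` or `1/(h − c)`, `c = h(∞)`) with `K(h') = K(h)` and `intDegree h' > 0` («for certain units `u, v`»).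
[cite: GutierrezSevilla2006, §3 Thm 20 (i) (proof), §3 (units)] -/
theorem exists_adjoin_eq_natDegree_denom_lt {h : RatFunc K} (hh : ¬ ∃ c, h = RatFunc.C c) :
    ∃ h' : RatFunc K, IntermediateField.adjoin K ({h'} : Set (RatFunc K)) =
        IntermediateField.adjoin K ({h} : Set (RatFunc K)) ∧ h'.denom.natDegree < h'.num.natDegree := by
  have hh0 : h ≠ 0 := fun h0 => hh ⟨0, by rw [h0, map_zero]⟩
  rcases lt_trichotomy h.denom.natDegree h.num.natDegree with hlt | heq | hgt
  · exact ⟨h, rfl, hlt⟩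
  · -- `h(∞) = c` finite and non-zero order: pass to `1/(h − c)`
    set c : K := h.num.leadingCoeff / h.denom.leadingCoeff with hc
    have hsub : h - RatFunc.C c ≠ 0 := by
      intro h0
      exact hh ⟨c, sub_eq_zero.mp h0⟩
    -- `intDegree (h − c) < 0`
    have hlt : (h - RatFunc.C c).intDegree < 0 := by
      have hform : h - RatFunc.C c =
          algebraMap K[X] (RatFunc K) (h.num - Polynomial.C c * h.denom) / algebraMap K[X] (RatFunc K) h.denom := by
        rw [map_sub, map_mul, RatFunc.algebraMap_C, sub_div, mul_div_assoc,
          div_self ((map_ne_zero_iff _ (IsFractionRing.injective K[X] (RatFunc K))).mpr h.denom_ne_zero), mul_one, RatFunc.num_div_denom]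
      have hnum0 : h.num - Polynomial.C c * h.denom ≠ 0 := by
        intro h0
        apply hsub
        rw [hform, h0, map_zero, zero_div]
      have hdeglt : (h.num - Polynomial.C c * h.denom).natDegree < h.denom.natDegree := by
        have hc0 : c ≠ 0 := div_ne_zero (leadingCoeff_ne_zero.mpr (RatFunc.num_ne_zero hh0))
          (leadingCoeff_ne_zero.mpr h.denom_ne_zero)
        have hdeg : (h.num).degree = (Polynomial.C c * h.denom).degree := by
          rw [degree_C_mul hc0, degree_eq_natDegree (RatFunc.num_ne_zero hh0), degree_eq_natDegree h.denom_ne_zero, heq]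
        have hlc : h.num.leadingCoeff = (Polynomial.C c * h.denom).leadingCoeff := by
          rw [leadingCoeff_mul, leadingCoeff_C, hc, div_mul_cancel₀ _ (leadingCoeff_ne_zero.mpr h.denom_ne_zero)]
        have := degree_sub_lt hdeg (RatFunc.num_ne_zero hh0) hlc
        rw [degree_eq_natDegree (RatFunc.num_ne_zero hh0), degree_eq_natDegree hnum0, ← heq] at this
        exact_mod_cast this
      rw [hform]
      rw [div_eq_mul_inv, RatFunc.intDegree_mul (by rw [Ne, map_eq_zero_iff _ (IsFractionRing.injective K[X] (RatFunc K))]; exact hnum0)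
        (inv_ne_zero ((map_ne_zero_iff _ (IsFractionRing.injective K[X] (RatFunc K))).mpr h.denom_ne_zero)),
        RatFunc.intDegree_inv, RatFunc.intDegree_polynomial, RatFunc.intDegree_polynomial]
      omega
    refine ⟨(h - RatFunc.C c)⁻¹, by rw [adjoin_inv_eq, adjoin_sub_C_eq], ?_⟩
    have : 0 < (h - RatFunc.C c)⁻¹.intDegree := by rw [RatFunc.intDegree_inv]; omega
    rw [RatFunc.intDegree] at this
    omega
  · refine ⟨h⁻¹, adjoin_inv_eq h, ?_⟩
    have : 0 < h⁻¹.intDegree := by rw [RatFunc.intDegree_inv, RatFunc.intDegree]; omega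
    rw [RatFunc.intDegree] at this
    omega

end IntDegree

section Indecomposable

/-! ### §2. `x^{n+1}/(x − 1)` is indecomposable -/

/-- **An indecomposable rational function of every degree: `x^{n+1}/(x − 1)` is indecomposable over any field**
(`n ≥ 1`). If `x^{n+1}/(x−1) = g ∘ h` with `h` normalised to have a pole at `∞`, then `deg g · deg h = n + 1` while
`intDegree g · intDegree h = n`; with `0 < intDegree h ≤ deg h` and `intDegree g ≤ deg g` this forces `deg g = 1` or
`deg h = 1` («the degree is multiplicative with respect to composition, and so is the difference in the degrees of
numerator and denominator … there is no possible decomposition»).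
[cite: GutierrezSevilla2006, §3 Thm 20 (i) (proof, the function x^{q+1}/(x−1))] -/
theorem isCoatom_adjoin_X_pow_succ_div_X_sub_one {n : ℕ} (hn : 1 ≤ n) :
    IsCoatom (IntermediateField.adjoin K
      ({algebraMap K[X] (RatFunc K) (X ^ (n + 1)) / algebraMap K[X] (RatFunc K) (X - 1)} : Set (RatFunc K))) := by
  set f : RatFunc K := algebraMap K[X] (RatFunc K) (X ^ (n + 1)) / algebraMap K[X] (RatFunc K) (X - 1) with hf
  have hinj := IsFractionRing.injective K[X] (RatFunc K)
  have hX1 : (X - 1 : K[X]) ≠ 0 := by simpa using X_sub_C_ne_zero (1 : K)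
  have hcop : IsCoprime (X ^ (n + 1) : K[X]) (X - 1) := by
    have h1 : IsCoprime (X : K[X]) (X - 1) := ⟨1, -1, by ring⟩
    exact h1.pow_left
  obtain ⟨hnum, hden⟩ := natDegree_num_div_and_denom_div_of_isCoprime (K := K) hcop hX1
  rw [← hf] at hnum hden
  rw [natDegree_pow, natDegree_X, mul_one] at hnum
  have hden' : f.denom.natDegree = 1 := by rw [hden]; simpa using natDegree_X_sub_C (1 : K)
  have hdegf : max f.num.natDegree f.denom.natDegree = n + 1 := by rw [hnum, hden']; omega
  have hintf : f.intDegree = n := by rw [RatFunc.intDegree, hnum, hden']; omega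
  have hf0 : f ≠ 0 := by
    intro h0; rw [h0, RatFunc.num_zero, natDegree_zero] at hnum; omega
  have hfC : ¬ ∃ c, f = RatFunc.C c := by
    rintro ⟨c, hc⟩
    rw [hc, RatFunc.num_C, natDegree_C] at hnum; omega
  refine ⟨fun htop => ?_, fun M hM => ?_⟩
  · rw [adjoin_eq_top_iff_max_natDegree_eq_one, hdegf] at htop; omega
  · -- `M = K(h)` with `h` normalised, `f = g ∘ h`
    have hMb : M ≠ ⊥ := ne_bot_of_gt hM
    obtain ⟨h, hhM, hh⟩ := exists_adjoin_eq_natDegree_denom_lt (RatFunc.Luroth.generator_ne_C hMb)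
    rw [← RatFunc.Luroth.eq_adjoin_generator (E := M)] at hhM
    have hhC : ¬ ∃ c, h = RatFunc.C c := by
      rintro ⟨c, rfl⟩
      rw [RatFunc.num_C, RatFunc.denom_C, natDegree_C, natDegree_one] at hh
      exact lt_irrefl _ hh
    rw [← hhM] at hM ⊢
    obtain ⟨g, hg⟩ := (mem_adjoin_iff_exists_ratFuncSubst h hhC f).mp (adjoin_simple_le_iff.mp hM.le)
    have hg0 : g ≠ 0 := by rintro rfl; rw [map_zero] at hg; exact hf0 hg
    -- degrees
    have hdeg := max_natDegree_ratFuncSubst h hhC g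
    rw [← hg, hdegf] at hdeg
    have hdegZ : (n : ℤ) + 1 = (max g.num.natDegree g.denom.natDegree : ℕ) *
        (max h.num.natDegree h.denom.natDegree : ℕ) := by exact_mod_cast hdeg
    have hint := intDegree_ratFuncSubst_of_lt hhC hh hg0
    rw [← hg, hintf] at hint
    have hbg := intDegree_le_max_natDegree g
    have hbh := intDegree_le_max_natDegree h
    have hhpos : 0 < h.intDegree := by rw [RatFunc.intDegree]; omega
    set a := max g.num.natDegree g.denom.natDegree with ha
    set b := max h.num.natDegree h.denom.natDegree with hb
    set dg := g.intDegree
    set dh := h.intDegree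
    -- `a = 1` or `b = 1`
    have hab : a = 1 ∨ b = 1 := by
      by_contra hcon
      have ha2 : 2 ≤ a := by
        rcases Nat.lt_or_ge a 2 with h1 | h1
        · interval_cases a
          · omega
          · exact absurd (Or.inl rfl) hcon
        · exact h1
      have hb2 : 2 ≤ b := by
        rcases Nat.lt_or_ge b 2 with h1 | h1
        · interval_cases b
          · omega
          · exact absurd (Or.inr rfl) hcon
        · exact h1
      have hdgpos : 0 < dg := by
        by_contra hle
        have : dg * dh ≤ 0 := Int.mul_nonpos_of_nonpos_of_nonneg (not_lt.mp hle) hhpos.le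
        omega
      -- `dg ≤ a - 1` (else `a ∣ ab - 1`)
      have hdga : dg ≤ (a : ℤ) - 1 := by
        by_contra hlt
        have hdgeq : dg = a := le_antisymm hbg (by omega)
        have h1 : (a : ℤ) * dh = (a : ℤ) * b - 1 := by rw [hdgeq] at hint; linarith
        have h2 : (a : ℤ) ∣ 1 := ⟨b - dh, by linarith⟩
        have h3 := Int.eq_one_of_dvd_one (by omega) h2
        omega
      have : dg * dh ≤ ((a : ℤ) - 1) * b := by nlinarith
      have : (n : ℤ) ≤ (a : ℤ) * b - b := by linarith
      omega
    rcases hab with ha1 | hb1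
    · -- `deg g = 1`: `K(f) = K(h)`, contradiction with `K(f) < K(h)`
      exact absurd ((adjoin_eq_adjoin_iff_exists_ratFuncSubst h hhC f).mpr ⟨g, hg, ha1⟩) hM.ne
    · exact (adjoin_eq_top_iff_max_natDegree_eq_one h).mpr hb1

/-- **Indecomposability is a property of the class modulo units**: `K(f ∘ v)` is a coatom for every Möbius `v`
(`deg v = 1`) as soon as `K(f)` is («… and the original function is also indecomposable»).
[cite: GutierrezSevilla2006, §3 Thm 20 (i) (proof)] -/
theorem isCoatom_adjoin_ratFuncSubst_of_max_natDegree_eq_one {v : RatFunc K} (hv : ¬ ∃ c, v = RatFunc.C c)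
    (hv1 : max v.num.natDegree v.denom.natDegree = 1) {f : RatFunc K}
    (hf : IsCoatom (IntermediateField.adjoin K ({f} : Set (RatFunc K)))) :
    IsCoatom (IntermediateField.adjoin K ({ratFuncSubst v hv f} : Set (RatFunc K))) := by
  rw [← covBy_top_iff, ← (adjoin_eq_top_iff_max_natDegree_eq_one v).mpr hv1]
  exact (covBy_adjoin_ratFuncSubst_iff v hv f).mpr hf

/-! ### §3. Gutierrez–Sevilla's Theorem 20 (i) -/

variable (p : ℕ) [hp : Fact p.Prime] [CharP K p]

/-- **GUTIERREZ–SEVILLA THEOREM 20 (i): `h_q = (x^{q+1} + x + 1)/x^q` is indecomposable** (`q = p^m`, over any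
field of characteristic `p`): `h_q + 1 = (x+1)^{q+1}/x^q = (x^{q+1}/(x − 1)) ∘ ((x+1)/x)`, a Möbius transform of
the indecomposable `x^{q+1}/(x−1)` («for certain units `u, v`, `u ∘ h_q ∘ v = x^{q+1}/(x−1)`»).
[cite: GutierrezSevilla2006, §3 Thm 20 (i)] -/
theorem gutierrezSevilla_theorem_20_i (m : ℕ) :
    IsCoatom (IntermediateField.adjoin K
      ({algebraMap K[X] (RatFunc K) (X ^ (p ^ m + 1) + X + 1) / algebraMap K[X] (RatFunc K) (X ^ p ^ m)} :
        Set (RatFunc K))) := by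
  set q := p ^ m with hq
  have hq1 : 1 ≤ q := Nat.one_le_pow _ _ hp.out.pos
  have hinj := IsFractionRing.injective K[X] (RatFunc K)
  -- the unit `v = (x+1)/x`
  set v : RatFunc K := algebraMap K[X] (RatFunc K) (X + 1) / algebraMap K[X] (RatFunc K) X with hvdef
  have hcop : IsCoprime (X + 1 : K[X]) X := ⟨1, -1, by ring⟩
  obtain ⟨hvnum, hvden⟩ := natDegree_num_div_and_denom_div_of_isCoprime (K := K) hcop X_ne_zero
  rw [← hvdef] at hvnum hvden
  have hX1 : ((X : K[X]) + 1).natDegree = 1 := by simpa using natDegree_X_add_C (1 : K)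
  have hv1 : max v.num.natDegree v.denom.natDegree = 1 := by
    rw [hvnum, hvden, natDegree_X, hX1, max_self]
  have hv : ¬ ∃ c, v = RatFunc.C c := by
    rintro ⟨c, hc⟩
    rw [hc, RatFunc.num_C, RatFunc.denom_C, natDegree_C, natDegree_one] at hv1
    simp at hv1
  -- `h_q + 1 = (x^{q+1}/(x−1)) ∘ v`
  have hX0 : (algebraMap K[X] (RatFunc K) X) ≠ 0 := (map_ne_zero_iff _ hinj).mpr X_ne_zero
  have hfrob : ((X : K[X]) + 1) ^ (q + 1) = X ^ (q + 1) + X ^ q + X + 1 := by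
    rw [pow_succ, hq, add_pow_char_pow, one_pow]; ring
  have hkey : ratFuncSubst v hv (algebraMap K[X] (RatFunc K) (X ^ (q + 1)) / algebraMap K[X] (RatFunc K) (X - 1)) =
      algebraMap K[X] (RatFunc K) (X ^ (q + 1) + X + 1) / algebraMap K[X] (RatFunc K) (X ^ q) - RatFunc.C (-1) := by
    rw [ratFuncSubst_div, map_pow, aeval_X, map_sub, aeval_X, map_one]
    have hv' : v - 1 = (algebraMap K[X] (RatFunc K) X)⁻¹ := by
      rw [hvdef, map_add, map_one, add_div, div_self hX0, add_sub_cancel_left, one_div]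
    rw [hv', hvdef, map_neg, map_one, sub_neg_eq_add, div_pow, ← map_pow, hfrob]
    simp only [map_add, map_pow, map_one]
    field_simp
    ring
  have h := isCoatom_adjoin_ratFuncSubst_of_max_natDegree_eq_one hv hv1
    (isCoatom_adjoin_X_pow_succ_div_X_sub_one (K := K) hq1)
  rwa [hkey, adjoin_sub_C_eq] at h

end Indecomposable

end Literature.FieldTheory.FunctionField
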